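import Mathlib
import Literature.Combinatorics.Optimization.MotzkinStrausCopositive
import Literature.Algebra.Polynomial.ParriloCopositiveSos
import HarnessLib

/-!
# Copositivity detection by simplicial partition (Bundfuss–Dür; Sponsel–Bundfuss–Dür)

The barycentric-coordinate criteria for copositivity of a real symmetric matrix, formalised
verbatim from the literature with complete proofs and no new axioms.  Throughout, `A : Matrix n n ℝ`
is the matrix under test, `IsCopositive` is the tree's
`Literature.Combinatorics.Optimization.MotzkinStrausCopositive.IsCopositive`
(`xᵀAx ≥ 0` for every entrywise nonnegative `x`), `Δ^S = stdSimplex ℝ n` is the standard simplex,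
and a simplex (more generally a polytope) inside `ℝⁿ` is presented, as in
[cite: SponselBundfussDur2011, §2.1], by a **vertex matrix** `V : Matrix n m ℝ` whose columns
`Vᵀ j` are its vertices: `vertexSimplex V = {V λ : λ ∈ Δ^S_m} = conv {Vᵀ j}`
(`vertexSimplex_eq_convexHull`).

* **Strict copositivity** (`IsStrictlyCopositive`) [cite: BundfussDur2008, §1]
  [cite: SponselBundfussDur2011, §1] and **homogeneity** [cite: BundfussDur2008, Lemma 1]
  [cite: SponselBundfussDur2011, §2.1]: `A` is (strictly) copositive iff `xᵀAx ≥ 0` (`> 0`) on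
  `Δ^S` (`isCopositive_iff_stdSimplex`, `isStrictlyCopositive_iff_stdSimplex`).
* **Barycentric change of variables** [cite: SponselBundfussDur2011, proof of Thm 2.1]
  [cite: Dur2010, §4 (6)]: `(Vλ)ᵀA(Vμ) = λᵀ(VᵀAV)μ` (`simplicial_conj_form`) and
  `(VᵀAV)ᵢⱼ = vᵢᵀAvⱼ` (`simplicial_conj_apply`); hence the **cone transfer**
  [cite: BundfussDur2008, §4]: `xᵀAx ≥ 0` on the cone generated by the columns of `V` iff
  `VᵀAV` is copositive (`simplicial_nonneg_on_cone_iff`), `xᵀAx ≥ 0` (`> 0`) on the simplex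
  `vertexSimplex V` iff `VᵀAV` is (strictly) copositive (`simplicial_nonneg_on_vertexSimplex_iff`,
  `simplicial_pos_on_vertexSimplex_iff`).
* **Vertex criteria on one simplex**: if `vᵢᵀAvⱼ ≥ c` for all vertex pairs then `xᵀAx ≥ c` on the
  simplex — `c = 0` is [cite: BundfussDur2008, Lemma 2], `c = -ε` is the **ε-copositivity bound**
  [cite: BundfussDur2008, Lemma 6] (`simplicial_le_form_of_entry_le`); if `vᵢᵀAvⱼ ≥ 0` for all
  pairs and `vᵢᵀAvᵢ > 0` for all vertices then `xᵀAx > 0` on the simplex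
  [cite: BundfussDur2008, Lemma 5 (contrapositive)] (`simplicial_pos_of_entry_nonneg_of_diag_pos`).
* **Sufficient condition from a simplicial partition** — Sponsel–Bundfuss–Dür's
  [cite: SponselBundfussDur2011, Thm 2.1]: if `Δ^S` is covered by simplices `Δ_V`, `V ∈ F`, and
  every `VᵀAV` lies in a set `M ⊆ COP` of copositive matrices, then `A` is copositive
  (`isCopositive_of_simplicialCover`; only the covering half `Δ^S ⊆ ⋃ Δ_V` of "partition"
  [cite: BundfussDur2008, Def 1] is used, exactly as in the published proof); the instances
  `M = 𝒩` (entrywise nonnegative) [cite: BundfussDur2008, Thm 1]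
  (`isCopositive_of_simplicialCover_entry_nonneg`), `M = 𝒮₊ + 𝒩`
  [cite: SponselBundfussDur2011, §2.2–2.3] (`isCopositive_of_simplicialCover_psd_add_nonneg`, via the
  tree's `ParriloCopositiveSos.copositive_of_posSemidef_add_nonneg`), the strict variant
  (`isStrictlyCopositive_of_simplicialCover`) and the **certified lower bound**
  `min_{Δ^S} xᵀAx ≥ c` from `vᵢᵀAvⱼ ≥ c` on every simplex of the cover
  [cite: BundfussDur2008, §3.2 (Lemma 6)] (`simplicial_le_form_on_stdSimplex_of_cover`).
* **Necessary conditions**: a nonnegative vector with `vᵀAv < 0` refutes copositivity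
  [cite: BundfussDur2008, Algorithm 1 (Steps 6–7)] [cite: SponselBundfussDur2011, Lemma 2.3]
  (`not_isCopositive_of_form_neg`); **Bundfuss–Dür's Theorem 2** [cite: BundfussDur2008, Thm 2]
  [cite: SponselBundfussDur2011, Thm 2.2]: if `A` is strictly copositive there is `δ > 0` such that
  `uᵀAv > 0` for all `u, v ∈ Δ^S` at distance `< δ` (`exists_delta_form_pos_of_isStrictlyCopositive`),
  so every simplex of a sufficiently fine partition with vertices in `Δ^S` has `VᵀAV` entrywise
  positive (`simplicial_conj_entry_pos_of_fine`); and [cite: SponselBundfussDur2011, Lemma 2.3]: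
  if `A` is not copositive there is `δ > 0` such that every cover of `Δ^S` by simplices of
  diameter `< δ` has a vertex `v` with `vᵀAv < 0` (`exists_delta_vertex_neg_of_not_isCopositive`).
  Distances are those of Mathlib's sup metric on `n → ℝ`; since the sup distance is dominated by
  the Euclidean one, both statements imply their Euclidean-diameter versions in the sources.
* **Cone-copositivity** [cite: BundfussDur2008, §4]: `A` is `D`-copositive when `xᵀAx ≥ 0` on
  `{x : Dx ≥ 0}` (`IsConeCopositive`); `D = I` is copositivity and `D = 0` is positive
  semidefiniteness of the form (`isConeCopositive_one_iff`, `isConeCopositive_zero_iff`).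

Not formalised here: the existence of arbitrarily fine simplicial partitions (bisection along
the longest edge, [cite: BundfussDur2008, §3.1]) and the iteration bound
[cite: BundfussDur2008, Prop 1]; accordingly the converse half of
[cite: SponselBundfussDur2011, Lemma 2.3] is stated pointwise (`not_isCopositive_of_form_neg`).

## References

* S. Bundfuss, M. Dür, *Algorithmic copositivity detection by simplicial partition*, Linear
  Algebra Appl. 428 (2008) 1511–1523. [BundfussDur2008]
* J. Sponsel, S. Bundfuss, M. Dür, *An improved algorithm to test copositivity*, J. Global
  Optim. 52 (2012) 537–551. [SponselBundfussDur2011]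
* M. Dür, *Copositive programming — a survey*, in: Recent Advances in Optimization and its
  Applications in Engineering, Springer (2010) 3–20. [Dur2010]
-/

noncomputable section

open Finset Matrix Set

namespace Literature.Combinatorics.Optimization.CopositivitySimplicialPartition

open Literature.Combinatorics.Optimization.MotzkinStrausCopositive (IsCopositive)
open Literature.Algebra.Polynomial.ParriloCopositiveSos (copositive_of_posSemidef_add_nonneg)

variable {n m p : Type*} [Fintype n] [Fintype m]

/-! ## Strict copositivity and homogeneity -/

/-- A real matrix `A` is *strictly copositive* when `xᵀAx > 0` for every entrywise nonnegative
`x ≠ 0` [cite: BundfussDur2008, §1] [cite: SponselBundfussDur2011, §1]. -/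
def IsStrictlyCopositive (A : Matrix n n ℝ) : Prop :=
  ∀ x : n → ℝ, (∀ i, 0 ≤ x i) → x ≠ 0 → 0 < x ⬝ᵥ A *ᵥ x

/-- The quadratic form is homogeneous of degree two. [folklore] -/
@[folklore] private theorem form_smul (A : Matrix n n ℝ) (c : ℝ) (x : n → ℝ) :
    (c • x) ⬝ᵥ A *ᵥ (c • x) = c ^ 2 * (x ⬝ᵥ A *ᵥ x) := by
  rw [Matrix.mulVec_smul, dotProduct_smul, smul_dotProduct, smul_eq_mul, smul_eq_mul, sq, mul_assoc]

/-- A nonnegative vector with coordinate sum `0` is `0`. [folklore] -/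
@[folklore] private theorem eq_zero_of_sum_eq_zero {x : n → ℝ} (hx : ∀ i, 0 ≤ x i)
    (hs : ∑ i, x i = 0) : x = 0 := by
  funext i
  exact (Finset.sum_eq_zero_iff_of_nonneg fun i _ => hx i).1 hs i (Finset.mem_univ i)

/-- A nonnegative vector with coordinate sum `s > 0` rescales into the standard simplex.
[folklore] -/
@[folklore] private theorem inv_smul_mem_stdSimplex {x : n → ℝ} (hx : ∀ i, 0 ≤ x i)
    (hs : 0 < ∑ i, x i) : (∑ i, x i)⁻¹ • x ∈ stdSimplex ℝ n := by
  refine ⟨fun i => ?_, ?_⟩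
  · simpa only [Pi.smul_apply, smul_eq_mul] using mul_nonneg (inv_nonneg.2 hs.le) (hx i)
  · simp only [Pi.smul_apply, smul_eq_mul, ← Finset.mul_sum]
    exact inv_mul_cancel₀ (ne_of_gt hs)

/-- A point of the standard simplex is not the zero vector. [folklore] -/
@[folklore] private theorem ne_zero_of_mem_stdSimplex {x : n → ℝ} (hx : x ∈ stdSimplex ℝ n) :
    x ≠ 0 := by
  rintro rfl
  have h := hx.2
  simp at h

/-- A strictly copositive matrix is copositive [cite: SponselBundfussDur2011, §1]
[cite: BundfussDur2008, §1]. -/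
theorem IsStrictlyCopositive.isCopositive {A : Matrix n n ℝ} (hA : IsStrictlyCopositive A) :
    IsCopositive A := by
  intro x hx
  by_cases h0 : x = 0
  · subst h0; simp
  · exact (hA x hx h0).le

/-- **Homogeneity** [cite: BundfussDur2008, Lemma 1] [cite: SponselBundfussDur2011, §2.1
("A is copositive if and only if xᵀAx ≥ 0 for all x ≥ 0 with ‖x‖₁ = 1")]: `A` is copositive iff
its quadratic form is nonnegative on the standard simplex `Δ^S`. -/
theorem isCopositive_iff_stdSimplex (A : Matrix n n ℝ) :
    IsCopositive A ↔ ∀ x ∈ stdSimplex ℝ n, 0 ≤ x ⬝ᵥ A *ᵥ x := by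
  refine ⟨fun h x hx => h x hx.1, fun h x hx => ?_⟩
  rcases (Finset.sum_nonneg fun i _ => hx i).eq_or_lt with hs | hs
  · rw [eq_zero_of_sum_eq_zero hx hs.symm]; simp
  · have hu := h _ (inv_smul_mem_stdSimplex hx hs)
    rw [form_smul] at hu
    have hpos : 0 < ((∑ i, x i)⁻¹) ^ 2 := by positivity
    exact nonneg_of_mul_nonneg_right (by simpa [mul_comm] using hu) hpos

/-- **Homogeneity, strict form** [cite: BundfussDur2008, Lemma 1]
[cite: SponselBundfussDur2011, §2.1]: `A` is strictly copositive iff its quadratic form is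
positive on `Δ^S`. -/
theorem isStrictlyCopositive_iff_stdSimplex (A : Matrix n n ℝ) :
    IsStrictlyCopositive A ↔ ∀ x ∈ stdSimplex ℝ n, 0 < x ⬝ᵥ A *ᵥ x := by
  refine ⟨fun h x hx => h x hx.1 (ne_zero_of_mem_stdSimplex hx), fun h x hx hx0 => ?_⟩
  rcases (Finset.sum_nonneg fun i _ => hx i).eq_or_lt with hs | hs
  · exact absurd (eq_zero_of_sum_eq_zero hx hs.symm) hx0
  · have hu := h _ (inv_smul_mem_stdSimplex hx hs)
    rw [form_smul] at hu
    have hpos : 0 < ((∑ i, x i)⁻¹) ^ 2 := by positivity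
    exact pos_of_mul_pos_right (by simpa [mul_comm] using hu) hpos.le

/-- A nonnegative vector on which the form is negative refutes copositivity — the test
`vᵀAv < 0 ⇒ "A is not copositive"` of [cite: BundfussDur2008, Algorithm 1 (Steps 6–7)], and the
easy implication `2 ⇒ 1` of [cite: SponselBundfussDur2011, Lemma 2.3]. -/
theorem not_isCopositive_of_form_neg {A : Matrix n n ℝ} {v : n → ℝ} (hv : ∀ i, 0 ≤ v i)
    (hneg : v ⬝ᵥ A *ᵥ v < 0) : ¬ IsCopositive A :=
  fun h => absurd (h v hv) (not_le.2 hneg)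

/-! ## Vertex matrices and barycentric coordinates -/

/-- The simplex (in general, polytope) with vertex matrix `V`: the image `{Vλ : λ ∈ Δ^S_m}` of the
standard simplex, i.e. the points with barycentric coordinates `λ ≥ 0`, `∑ λⱼ = 1` with respect to
the columns `Vᵀ j` of `V` [cite: SponselBundfussDur2011, §2.1 ("a simplex … can be represented by
a matrix V whose columns are these vertices")] [cite: BundfussDur2008, §2 (proof of Lemma 2)]. -/
def vertexSimplex (V : Matrix n m ℝ) : Set (n → ℝ) := V.mulVecLin '' stdSimplex ℝ m

omit [Fintype n] in
/-- Membership in `Δ_V` is a barycentric representation `x = Vλ`, `λ ∈ Δ^S_m`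
[cite: SponselBundfussDur2011, §2.1, proof of Thm 2.1 ("we represent x in barycentric coordinates
with respect to Δ: x = ∑ λᵢvᵢ = Vλ")] [cite: BundfussDur2008, §2 (proof of Lemma 2)]. -/
theorem mem_vertexSimplex_iff {V : Matrix n m ℝ} {x : n → ℝ} :
    x ∈ vertexSimplex V ↔ ∃ l ∈ stdSimplex ℝ m, V *ᵥ l = x := by
  simp [vertexSimplex]

omit [Fintype n] in
/-- Every barycentric combination `Vλ`, `λ ∈ Δ^S_m`, lies in `Δ_V`
[cite: SponselBundfussDur2011, §2.1] [cite: BundfussDur2008, §2 (proof of Lemma 2)]. -/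
theorem mulVec_mem_vertexSimplex (V : Matrix n m ℝ) {l : m → ℝ} (hl : l ∈ stdSimplex ℝ m) :
    V *ᵥ l ∈ vertexSimplex V :=
  mem_vertexSimplex_iff.2 ⟨l, hl, rfl⟩

omit [Fintype n] in
/-- `V eⱼ` is the `j`-th column of `V`. [folklore] -/
@[folklore] private theorem mulVec_single_one_eq_col [DecidableEq m] (V : Matrix n m ℝ) (j : m) :
    V *ᵥ Pi.single j 1 = Vᵀ j := by
  ext i
  simp [Matrix.mulVec, dotProduct, Pi.single_apply, Matrix.transpose_apply]

omit [Fintype n] in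
/-- `Vλ = ∑ⱼ λⱼ vⱼ`. [folklore] -/
@[folklore] private theorem mulVec_eq_sum_smul_col (V : Matrix n m ℝ) (l : m → ℝ) :
    V *ᵥ l = ∑ j, l j • Vᵀ j := by
  ext i
  simp [Matrix.mulVec, dotProduct, Finset.sum_apply, Matrix.transpose_apply, mul_comm]

omit [Fintype n] in
/-- The vertices belong to the simplex [cite: SponselBundfussDur2011, §2.1]. -/
theorem col_mem_vertexSimplex (V : Matrix n m ℝ) (j : m) : Vᵀ j ∈ vertexSimplex V := by
  classical
  rw [← mulVec_single_one_eq_col]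
  exact mulVec_mem_vertexSimplex V (single_mem_stdSimplex ℝ j)

omit [Fintype n] in
/-- The vertex-matrix simplex is convex. [cite: SponselBundfussDur2011, §2.1] -/
theorem convex_vertexSimplex (V : Matrix n m ℝ) : Convex ℝ (vertexSimplex V) :=
  (convex_stdSimplex ℝ m).linear_image _

omit [Fintype n] in
/-- The vertex-matrix simplex is compact. [cite: SponselBundfussDur2011, §2.1] -/
theorem isCompact_vertexSimplex (V : Matrix n m ℝ) : IsCompact (vertexSimplex V) :=
  (isCompact_stdSimplex ℝ m).image V.mulVecLin.continuous_of_finiteDimensional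

omit [Fintype n] in
/-- `vertexSimplex V` is the convex hull `conv{v₁, …, v_m}` of the columns of `V`
[cite: SponselBundfussDur2011, §2.1 ("the convex hull of n affinely independent points")]
[cite: BundfussDur2008, §2] (affine independence is not needed for anything below). -/
theorem vertexSimplex_eq_convexHull (V : Matrix n m ℝ) :
    vertexSimplex V = convexHull ℝ (Set.range Vᵀ) := by
  refine Subset.antisymm ?_ (convexHull_min (Set.range_subset_iff.2 (col_mem_vertexSimplex V))
    (convex_vertexSimplex V))
  rintro x hx
  obtain ⟨l, hl, rfl⟩ := mem_vertexSimplex_iff.1 hx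
  rw [mulVec_eq_sum_smul_col]
  exact (convex_convexHull ℝ _).sum_mem (fun j _ => hl.1 j) hl.2
    fun j _ => subset_convexHull ℝ _ (Set.mem_range_self j)

/-- **Barycentric change of variables** [cite: SponselBundfussDur2011, proof of Thm 2.1
("xᵀAx = λᵀVᵀAVλ")] [cite: Dur2010, §4 (6)]: `(Vλ)ᵀ A (Vμ) = λᵀ (VᵀAV) μ`. -/
theorem simplicial_conj_form (A : Matrix n n ℝ) (V : Matrix n m ℝ) (l μ : m → ℝ) :
    (V *ᵥ l) ⬝ᵥ A *ᵥ (V *ᵥ μ) = l ⬝ᵥ (Vᵀ * A * V) *ᵥ μ := by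
  calc (V *ᵥ l) ⬝ᵥ A *ᵥ (V *ᵥ μ) = (l ᵥ* Vᵀ) ⬝ᵥ A *ᵥ (V *ᵥ μ) := by
        rw [Matrix.vecMul_transpose]
    _ = l ⬝ᵥ Vᵀ *ᵥ (A *ᵥ (V *ᵥ μ)) := (Matrix.dotProduct_mulVec _ _ _).symm
    _ = l ⬝ᵥ (Vᵀ * A * V) *ᵥ μ := by rw [Matrix.mulVec_mulVec, Matrix.mulVec_mulVec, Matrix.mul_assoc]

/-- The entries of `VᵀAV` are the vertex-pair values `vᵢᵀ A vⱼ` of the bilinear form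
[cite: SponselBundfussDur2011, §2.2] [cite: BundfussDur2008, Thm 1] [cite: Dur2010, §4 (6)]. -/
theorem simplicial_conj_apply (A : Matrix n n ℝ) (V : Matrix n m ℝ) (i j : m) :
    (Vᵀ * A * V) i j = Vᵀ i ⬝ᵥ A *ᵥ Vᵀ j := by
  classical
  rw [← mulVec_single_one_eq_col V i, ← mulVec_single_one_eq_col V j, simplicial_conj_form]
  simp [Matrix.mulVec, dotProduct, Pi.single_apply]

/-- **Cone transfer** [cite: BundfussDur2008, §4 ("copositivity with respect to a polyhedral cone
with s extremal rays is equivalent to copositivity with respect to ℝˢ₊", via [EJ, Cor 2.21])]: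
the form of `A` is nonnegative on the cone `{Vμ : μ ≥ 0}` generated by the columns of `V` iff
`VᵀAV` is copositive. -/
theorem simplicial_nonneg_on_cone_iff (A : Matrix n n ℝ) (V : Matrix n m ℝ) :
    (∀ μ : m → ℝ, (∀ j, 0 ≤ μ j) → 0 ≤ (V *ᵥ μ) ⬝ᵥ A *ᵥ (V *ᵥ μ)) ↔ IsCopositive (Vᵀ * A * V) := by
  simp only [IsCopositive, simplicial_conj_form]

/-- The form of `A` is nonnegative on the simplex `Δ_V` iff `VᵀAV` is copositive
[cite: BundfussDur2008, Lemma 1, §4] [cite: SponselBundfussDur2011, proof of Thm 2.1]. -/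
theorem simplicial_nonneg_on_vertexSimplex_iff (A : Matrix n n ℝ) (V : Matrix n m ℝ) :
    (∀ x ∈ vertexSimplex V, 0 ≤ x ⬝ᵥ A *ᵥ x) ↔ IsCopositive (Vᵀ * A * V) := by
  rw [isCopositive_iff_stdSimplex]
  constructor
  · intro h l hl
    rw [← simplicial_conj_form]
    exact h _ (mulVec_mem_vertexSimplex V hl)
  · intro h x hx
    obtain ⟨l, hl, rfl⟩ := mem_vertexSimplex_iff.1 hx
    rw [simplicial_conj_form]
    exact h l hl

/-- The form of `A` is positive on the simplex `Δ_V` iff `VᵀAV` is strictly copositive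
[cite: BundfussDur2008, Lemma 1, §4] [cite: SponselBundfussDur2011, proof of Thm 2.1]. -/
theorem simplicial_pos_on_vertexSimplex_iff (A : Matrix n n ℝ) (V : Matrix n m ℝ) :
    (∀ x ∈ vertexSimplex V, 0 < x ⬝ᵥ A *ᵥ x) ↔ IsStrictlyCopositive (Vᵀ * A * V) := by
  rw [isStrictlyCopositive_iff_stdSimplex]
  constructor
  · intro h l hl
    rw [← simplicial_conj_form]
    exact h _ (mulVec_mem_vertexSimplex V hl)
  · intro h x hx
    obtain ⟨l, hl, rfl⟩ := mem_vertexSimplex_iff.1 hx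
    rw [simplicial_conj_form]
    exact h l hl

/-! ## Vertex criteria on one simplex -/

/-- The bilinear form written out. [folklore] -/
@[folklore] private theorem form_eq_sum {ι : Type*} [Fintype ι] (M : Matrix ι ι ℝ) (u w : ι → ℝ) :
    u ⬝ᵥ M *ᵥ w = ∑ i, ∑ j, u i * (M i j * w j) := by
  simp [dotProduct, Matrix.mulVec, Finset.mul_sum]

/-- On the standard simplex, a uniform lower bound `c` on the entries of `M` bounds the form:
`λᵀMλ ≥ c (∑ λᵢ)² = c`. [folklore] -/
@[folklore] private theorem le_form_stdSimplex_of_entry_le {M : Matrix m m ℝ} {c : ℝ}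
    (hM : ∀ i j, c ≤ M i j) {l : m → ℝ} (hl : l ∈ stdSimplex ℝ m) : c ≤ l ⬝ᵥ M *ᵥ l := by
  rw [form_eq_sum]
  calc c = ∑ i, ∑ j, l i * (c * l j) := by
        simp only [← Finset.mul_sum, ← Finset.sum_mul, hl.2, one_mul, mul_one]
    _ ≤ ∑ i, ∑ j, l i * (M i j * l j) :=
        Finset.sum_le_sum fun i _ => Finset.sum_le_sum fun j _ =>
          mul_le_mul_of_nonneg_left (mul_le_mul_of_nonneg_right (hM i j) (hl.1 j)) (hl.1 i)

/-- **Vertex criterion with a uniform bound** — [cite: BundfussDur2008, Lemma 2] (`c = 0`: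
"if vᵢᵀAvⱼ ≥ 0 for all i, j then xᵀAx ≥ 0 for all x ∈ Δ") and the **ε-copositivity bound**
[cite: BundfussDur2008, Lemma 6] (`c = -ε`: "if vᵢᵀAvⱼ ≥ -ε for all i, j then xᵀAx ≥ -ε for all
x ∈ Δ"): if every entry `vᵢᵀAvⱼ` of `VᵀAV` is `≥ c` then `xᵀAx ≥ c` on `Δ_V`. -/
theorem simplicial_le_form_of_entry_le {A : Matrix n n ℝ} {V : Matrix n m ℝ} {c : ℝ}
    (hV : ∀ i j, c ≤ (Vᵀ * A * V) i j) {x : n → ℝ} (hx : x ∈ vertexSimplex V) :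
    c ≤ x ⬝ᵥ A *ᵥ x := by
  obtain ⟨l, hl, rfl⟩ := mem_vertexSimplex_iff.1 hx
  rw [simplicial_conj_form]
  exact le_form_stdSimplex_of_entry_le hV hl

/-- [cite: BundfussDur2008, Lemma 2]: entrywise nonnegativity of `VᵀAV` (all `vᵢᵀAvⱼ ≥ 0`) gives
`xᵀAx ≥ 0` on `Δ_V`. -/
theorem simplicial_nonneg_of_entry_nonneg {A : Matrix n n ℝ} {V : Matrix n m ℝ}
    (hV : ∀ i j, 0 ≤ (Vᵀ * A * V) i j) {x : n → ℝ} (hx : x ∈ vertexSimplex V) :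
    0 ≤ x ⬝ᵥ A *ᵥ x :=
  simplicial_le_form_of_entry_le hV hx

/-- [cite: BundfussDur2008, Lemma 5 (contrapositive: "let Δ = conv{v₁,…,vₙ} with vᵢᵀAvᵢ > 0 for
all i; if some x ∈ Δ has xᵀAx = 0 then vᵢᵀAvⱼ < 0 for some i, j")]: if all `vᵢᵀAvⱼ ≥ 0` and all
`vᵢᵀAvᵢ > 0` then `xᵀAx > 0` on `Δ_V`. -/
theorem simplicial_pos_of_entry_nonneg_of_diag_pos {A : Matrix n n ℝ} {V : Matrix n m ℝ}
    (hV : ∀ i j, 0 ≤ (Vᵀ * A * V) i j) (hd : ∀ i, 0 < (Vᵀ * A * V) i i) {x : n → ℝ}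
    (hx : x ∈ vertexSimplex V) : 0 < x ⬝ᵥ A *ᵥ x := by
  obtain ⟨l, hl, rfl⟩ := mem_vertexSimplex_iff.1 hx
  rw [simplicial_conj_form, form_eq_sum]
  set M := Vᵀ * A * V with hMdef
  -- some barycentric coordinate is positive
  obtain ⟨i₀, hi₀⟩ : ∃ i, 0 < l i := by
    by_contra h
    have hle : ∀ i, l i ≤ 0 := fun i => not_lt.1 fun hi => h ⟨i, hi⟩
    have h0 : ∑ i, l i = 0 :=
      le_antisymm (Finset.sum_nonpos fun i _ => hle i) (Finset.sum_nonneg fun i _ => hl.1 i)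
    linarith [hl.2]
  have hterm : ∀ i j, 0 ≤ l i * (M i j * l j) := fun i j =>
    mul_nonneg (hl.1 i) (mul_nonneg (hV i j) (hl.1 j))
  calc (0 : ℝ) < l i₀ * (M i₀ i₀ * l i₀) := mul_pos hi₀ (mul_pos (hd i₀) hi₀)
    _ ≤ ∑ j, l i₀ * (M i₀ j * l j) :=
        Finset.single_le_sum (f := fun j => l i₀ * (M i₀ j * l j)) (fun j _ => hterm i₀ j)
          (Finset.mem_univ i₀)
    _ ≤ ∑ i, ∑ j, l i * (M i j * l j) :=
        Finset.single_le_sum (f := fun i => ∑ j, l i * (M i j * l j))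
          (fun i _ => Finset.sum_nonneg fun j _ => hterm i j) (Finset.mem_univ i₀)

/-! ## Sufficient conditions from a simplicial partition (cover) of `Δ^S` -/

/-- **Sponsel–Bundfuss–Dür's Theorem 2.1** [cite: SponselBundfussDur2011, Thm 2.1 ("Let A ∈ S, let
M ⊂ C, and let P be a simplicial partition of Δ^S. If VᵀAV ∈ M for all V ∈ M(P), then A is
copositive")], with `M ⊆ COP` inlined as "every `VᵀAV` is copositive": if the standard simplex is
covered by the simplices `Δ_V`, `V ∈ F`, and each `VᵀAV` is copositive, then `A` is copositive.
Only the covering property of the partition is used (as in the published proof). -/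
theorem isCopositive_of_simplicialCover {A : Matrix n n ℝ} {F : Set (Matrix n m ℝ)}
    (hcover : stdSimplex ℝ n ⊆ ⋃ V ∈ F, vertexSimplex V)
    (hM : ∀ V ∈ F, IsCopositive (Vᵀ * A * V)) : IsCopositive A := by
  rw [isCopositive_iff_stdSimplex]
  intro x hx
  obtain ⟨V, hV, hxV⟩ := Set.mem_iUnion₂.1 (hcover hx)
  exact (simplicial_nonneg_on_vertexSimplex_iff A V).2 (hM V hV) x hxV

/-- **Bundfuss–Dür's Theorem 1** [cite: BundfussDur2008, Thm 1 ("if (vᵢᵏ)ᵀAvⱼᵏ ≥ 0 for all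
k, i, j then A is copositive")] = [cite: SponselBundfussDur2011, Thm 2.1 (M = 𝒩)]: a cover of `Δ^S`
by simplices all of whose vertex-pair values `vᵢᵀAvⱼ` are nonnegative certifies copositivity. -/
theorem isCopositive_of_simplicialCover_entry_nonneg {A : Matrix n n ℝ} {F : Set (Matrix n m ℝ)}
    (hcover : stdSimplex ℝ n ⊆ ⋃ V ∈ F, vertexSimplex V)
    (hN : ∀ V ∈ F, ∀ i j, 0 ≤ (Vᵀ * A * V) i j) : IsCopositive A := by
  rw [isCopositive_iff_stdSimplex]
  intro x hx
  obtain ⟨V, hV, hxV⟩ := Set.mem_iUnion₂.1 (hcover hx)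
  exact simplicial_nonneg_of_entry_nonneg (hN V hV) hxV

/-- [cite: SponselBundfussDur2011, Thm 2.1 (M = 𝒮₊ + 𝒩), §2.3 ("if M ⊇ 𝒩 …")]: a cover of `Δ^S`
by simplices with `VᵀAV = P_V + N_V`, `P_V ⪰ 0`, `N_V ≥ 0` entrywise, certifies copositivity
(the per-simplex certificate is the tree's `copositive_of_posSemidef_add_nonneg`). -/
theorem isCopositive_of_simplicialCover_psd_add_nonneg {A : Matrix n n ℝ} {F : Set (Matrix n m ℝ)}
    (hcover : stdSimplex ℝ n ⊆ ⋃ V ∈ F, vertexSimplex V)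
    (hM : ∀ V ∈ F, ∃ P N : Matrix m m ℝ, P.PosSemidef ∧ (∀ i j, 0 ≤ N i j) ∧ Vᵀ * A * V = P + N) :
    IsCopositive A :=
  isCopositive_of_simplicialCover hcover fun V hV => by
    classical
    obtain ⟨P, N, hP, hN, hVPN⟩ := hM V hV
    exact fun x hx => copositive_of_posSemidef_add_nonneg hP hN hVPN x hx

/-- Strict variant [cite: BundfussDur2008, Lemma 5, Thm 1] [cite: SponselBundfussDur2011, Thm 2.1]:
a cover of `Δ^S` by simplices with all `vᵢᵀAvⱼ ≥ 0` and all `vᵢᵀAvᵢ > 0` certifies strict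
copositivity. -/
theorem isStrictlyCopositive_of_simplicialCover {A : Matrix n n ℝ} {F : Set (Matrix n m ℝ)}
    (hcover : stdSimplex ℝ n ⊆ ⋃ V ∈ F, vertexSimplex V)
    (hN : ∀ V ∈ F, ∀ i j, 0 ≤ (Vᵀ * A * V) i j) (hd : ∀ V ∈ F, ∀ i, 0 < (Vᵀ * A * V) i i) :
    IsStrictlyCopositive A := by
  rw [isStrictlyCopositive_iff_stdSimplex]
  intro x hx
  obtain ⟨V, hV, hxV⟩ := Set.mem_iUnion₂.1 (hcover hx)
  exact simplicial_pos_of_entry_nonneg_of_diag_pos (hN V hV) (hd V hV) hxV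

/-- More generally, a cover with every `VᵀAV` strictly copositive certifies strict copositivity
[cite: SponselBundfussDur2011, Thm 2.1] [cite: BundfussDur2008, Lemma 1]. -/
theorem isStrictlyCopositive_of_simplicialCover_strict {A : Matrix n n ℝ} {F : Set (Matrix n m ℝ)}
    (hcover : stdSimplex ℝ n ⊆ ⋃ V ∈ F, vertexSimplex V)
    (hM : ∀ V ∈ F, IsStrictlyCopositive (Vᵀ * A * V)) : IsStrictlyCopositive A := by
  rw [isStrictlyCopositive_iff_stdSimplex]
  intro x hx
  obtain ⟨V, hV, hxV⟩ := Set.mem_iUnion₂.1 (hcover hx)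
  exact (simplicial_pos_on_vertexSimplex_iff A V).2 (hM V hV) x hxV

/-- **Certified lower bound from a cover** [cite: BundfussDur2008, §3.2 (Lemma 6: "this criterion
immediately provides a lower bound on the minimum of the quadratic form xᵀAx")]: if every simplex
of a cover of `Δ^S` has all vertex-pair values `vᵢᵀAvⱼ ≥ c`, then `xᵀAx ≥ c` on `Δ^S`
(`c = -ε`: `A` is "ε-copositive", [cite: BundfussDur2008, Def 2]). -/
theorem simplicial_le_form_on_stdSimplex_of_cover {A : Matrix n n ℝ} {F : Set (Matrix n m ℝ)}
    {c : ℝ} (hcover : stdSimplex ℝ n ⊆ ⋃ V ∈ F, vertexSimplex V)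
    (hc : ∀ V ∈ F, ∀ i j, c ≤ (Vᵀ * A * V) i j) {x : n → ℝ} (hx : x ∈ stdSimplex ℝ n) :
    c ≤ x ⬝ᵥ A *ᵥ x := by
  obtain ⟨V, hV, hxV⟩ := Set.mem_iUnion₂.1 (hcover hx)
  exact simplicial_le_form_of_entry_le (hc V hV) hxV

/-! ## Necessary conditions: fine partitions -/

/-- The quadratic form is continuous. [folklore] -/
@[folklore] private theorem continuous_form (A : Matrix n n ℝ) :
    Continuous fun x : n → ℝ => x ⬝ᵥ A *ᵥ x :=
  continuous_id.dotProduct (continuous_const.matrix_mulVec continuous_id)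

/-- `|uᵀAw| ≤ (∑ᵢⱼ |aᵢⱼ|) · r` when `|uᵢ| ≤ 1` and `|wⱼ| ≤ r`. [folklore] -/
@[folklore] private theorem abs_form_le (A : Matrix n n ℝ) {u w : n → ℝ} {r : ℝ}
    (hu : ∀ i, |u i| ≤ 1) (hw : ∀ j, |w j| ≤ r) :
    |u ⬝ᵥ A *ᵥ w| ≤ (∑ i, ∑ j, |A i j|) * r := by
  rw [form_eq_sum, Finset.sum_mul]
  refine (Finset.abs_sum_le_sum_abs _ _).trans (Finset.sum_le_sum fun i _ => ?_)
  rw [Finset.sum_mul]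
  refine (Finset.abs_sum_le_sum_abs _ _).trans (Finset.sum_le_sum fun j _ => ?_)
  rw [abs_mul, abs_mul]
  calc |u i| * (|A i j| * |w j|) ≤ 1 * (|A i j| * r) :=
        mul_le_mul (hu i) (mul_le_mul_of_nonneg_left (hw j) (abs_nonneg _)) (by positivity)
          zero_le_one
    _ = |A i j| * r := one_mul _

/-- **Bundfuss–Dür's Theorem 2, metric form** [cite: BundfussDur2008, Thm 2 (proof: "Q(x, y) =
xᵀAy is strictly positive on the diagonal of Δ^S × Δ^S … uniformly continuous on the compact set
Δ^S × Δ^S")] [cite: SponselBundfussDur2011, Thm 2.2]: if `A` is strictly copositive there is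
`δ > 0` with `uᵀAv > 0` for all `u, v ∈ Δ^S` at (sup-)distance `< δ`.  The proof gives the
explicit `δ = μ / (∑ᵢⱼ |aᵢⱼ| + 1)`, `μ = min_{Δ^S} xᵀAx`. -/
theorem exists_delta_form_pos_of_isStrictlyCopositive {A : Matrix n n ℝ}
    (hA : IsStrictlyCopositive A) :
    ∃ δ > 0, ∀ u ∈ stdSimplex ℝ n, ∀ v ∈ stdSimplex ℝ n, dist u v < δ → 0 < u ⬝ᵥ A *ᵥ v := by
  rcases (stdSimplex ℝ n).eq_empty_or_nonempty with he | hne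
  · exact ⟨1, one_pos, fun u hu => by simp [he] at hu⟩
  obtain ⟨x₀, hx₀, hmin⟩ :=
    (isCompact_stdSimplex ℝ n).exists_isMinOn hne (continuous_form A).continuousOn
  have hμ : 0 < x₀ ⬝ᵥ A *ᵥ x₀ := (isStrictlyCopositive_iff_stdSimplex A).1 hA x₀ hx₀
  set μ := x₀ ⬝ᵥ A *ᵥ x₀ with hμdef
  set S := ∑ i, ∑ j, |A i j| with hSdef
  have hS : 0 ≤ S := Finset.sum_nonneg fun i _ => Finset.sum_nonneg fun j _ => abs_nonneg _
  have hS1 : 0 < S + 1 := by linarith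
  refine ⟨μ / (S + 1), div_pos hμ hS1, fun u hu v hv hd => ?_⟩
  have hsplit : u ⬝ᵥ A *ᵥ v = u ⬝ᵥ A *ᵥ u + u ⬝ᵥ A *ᵥ (v - u) := by
    rw [Matrix.mulVec_sub, dotProduct_sub]; ring
  have hmin_u : μ ≤ u ⬝ᵥ A *ᵥ u := (isMinOn_iff.1 hmin) u hu
  have hbound : |u ⬝ᵥ A *ᵥ (v - u)| ≤ S * dist u v := by
    refine abs_form_le A (fun i => ?_) (fun j => ?_)
    · have h := mem_Icc_of_mem_stdSimplex hu i
      exact abs_le.2 ⟨by linarith [h.1], h.2⟩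
    · rw [Pi.sub_apply, ← Real.dist_eq, dist_comm u v]
      exact dist_le_pi_dist v u j
  have hSd : S * dist u v ≤ S * (μ / (S + 1)) := mul_le_mul_of_nonneg_left hd.le hS
  have hkey : μ - S * (μ / (S + 1)) = μ / (S + 1) := by
    field_simp
    ring
  have hq : 0 < μ / (S + 1) := div_pos hμ hS1
  have h3 : -(S * dist u v) ≤ u ⬝ᵥ A *ᵥ (v - u) := by
    have := neg_abs_le (u ⬝ᵥ A *ᵥ (v - u))
    linarith
  rw [hsplit]
  linarith

/-- **Bundfuss–Dür's Theorem 2, partition form** [cite: BundfussDur2008, Thm 2 ("Let A be strictly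
copositive. Then there exists ε > 0 such that for all finite simplicial partitions P of Δ^S with
δ(P) ≤ ε we have (vᵢᵏ)ᵀAvⱼᵏ > 0 for all k, i, j")] [cite: SponselBundfussDur2011, Thm 2.2
(M ⊇ 𝒩)]: for a strictly copositive `A` there is `δ > 0` such that every vertex matrix `V` with
columns in `Δ^S` and pairwise column distances `< δ` has `VᵀAV` entrywise positive — so the
nonnegativity certificate of `isCopositive_of_simplicialCover_entry_nonneg` succeeds on every
sufficiently fine partition. -/
theorem exists_delta_conj_entry_pos_of_isStrictlyCopositive {A : Matrix n n ℝ}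
    (hA : IsStrictlyCopositive A) :
    ∃ δ > 0, ∀ V : Matrix n m ℝ, (∀ j, Vᵀ j ∈ stdSimplex ℝ n) →
      (∀ i j, dist (Vᵀ i) (Vᵀ j) < δ) → ∀ i j, 0 < (Vᵀ * A * V) i j := by
  obtain ⟨δ, hδ, h⟩ := exists_delta_form_pos_of_isStrictlyCopositive hA
  refine ⟨δ, hδ, fun V hV hfine i j => ?_⟩
  rw [simplicial_conj_apply]
  exact h _ (hV i) _ (hV j) (hfine i j)

/-- **Sponsel–Bundfuss–Dür's Lemma 2.3** (`1 ⇒ 2`) [cite: SponselBundfussDur2011, Lemma 2.3 ("The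
matrix A is not copositive ⇔ there exists ε > 0 such that for all partitions P of Δ^S with
δ(P) < ε there exists v ∈ V(P) with vᵀAv < 0")] [cite: BundfussDur2008, §3 ("once the simplicial
partition is sufficiently fine, a vertex v … falls into N_ε(x̄), i.e., vᵀAv < 0")]: if `A` is not
copositive there is `δ > 0` such that every cover of `Δ^S` by vertex-matrix simplices with
pairwise vertex distances `< δ` has a vertex `v` with `vᵀAv < 0`.  (The converse `2 ⇒ 1` is
`not_isCopositive_of_form_neg` applied to any one such cover.) -/
theorem exists_delta_vertex_neg_of_not_isCopositive {A : Matrix n n ℝ} (hA : ¬ IsCopositive A) :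
    ∃ δ > 0, ∀ F : Set (Matrix n m ℝ), stdSimplex ℝ n ⊆ ⋃ V ∈ F, vertexSimplex V →
      (∀ V ∈ F, ∀ i j, dist (Vᵀ i) (Vᵀ j) < δ) → ∃ V ∈ F, ∃ j, Vᵀ j ⬝ᵥ A *ᵥ Vᵀ j < 0 := by
  simp only [isCopositive_iff_stdSimplex, not_forall, not_le] at hA
  obtain ⟨x, hx, hneg⟩ := hA
  have hev : ∀ᶠ y in nhds x, y ⬝ᵥ A *ᵥ y < 0 :=
    (continuous_form A).continuousAt.eventually_lt continuousAt_const hneg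
  obtain ⟨δ, hδ, hball⟩ := Metric.eventually_nhds_iff.1 hev
  refine ⟨δ, hδ, fun F hcover hfine => ?_⟩
  obtain ⟨V, hV, hxV⟩ := Set.mem_iUnion₂.1 (hcover hx)
  obtain ⟨l, hl, hlx⟩ := mem_vertexSimplex_iff.1 hxV
  have hm : Nonempty m := by
    by_contra h
    rw [not_nonempty_iff] at h
    have h1 := hl.2
    simp [Finset.univ_eq_empty] at h1
  obtain ⟨j⟩ := hm
  refine ⟨V, hV, j, hball ?_⟩
  have hmem : V *ᵥ l ∈ Metric.ball (Vᵀ j) δ := by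
    rw [mulVec_eq_sum_smul_col]
    exact (convex_ball (Vᵀ j) δ).sum_mem (fun i _ => hl.1 i) hl.2
      fun i _ => Metric.mem_ball.2 (hfine V hV i j)
  rw [← hlx, dist_comm]
  exact Metric.mem_ball.1 hmem

/-! ## Cone-copositivity -/

/-- `A` is *`D`-copositive* (copositive with respect to the polyhedral cone `{x : Dx ≥ 0}`) when
`xᵀAx ≥ 0` for every `x` with `Dx ≥ 0` [cite: BundfussDur2008, §4 ("D-copositivity is a
generalization of both copositivity (choose D = I) and positive semidefiniteness (D = 0)")]. -/
def IsConeCopositive (D : Matrix p n ℝ) (A : Matrix n n ℝ) : Prop :=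
  ∀ x : n → ℝ, (∀ i, 0 ≤ (D *ᵥ x) i) → 0 ≤ x ⬝ᵥ A *ᵥ x

/-- `D = I`: cone-copositivity with respect to the nonnegative orthant is copositivity
[cite: BundfussDur2008, §4]. -/
theorem isConeCopositive_one_iff [DecidableEq n] (A : Matrix n n ℝ) :
    IsConeCopositive (1 : Matrix n n ℝ) A ↔ IsCopositive A := by
  simp [IsConeCopositive, IsCopositive, Matrix.one_mulVec]

/-- `D = 0`: cone-copositivity with respect to the whole space is positive semidefiniteness of the
form [cite: BundfussDur2008, §4]. -/
theorem isConeCopositive_zero_iff (A : Matrix n n ℝ) :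
    IsConeCopositive (0 : Matrix p n ℝ) A ↔ ∀ x : n → ℝ, 0 ≤ x ⬝ᵥ A *ᵥ x := by
  simp [IsConeCopositive, Matrix.zero_mulVec]

/-- Cone-copositivity with respect to a finitely generated cone `{Gμ : μ ≥ 0}` reduces to ordinary
copositivity of `GᵀAG` [cite: BundfussDur2008, §4 ("copositivity with respect to a polyhedral cone
with s extremal rays is equivalent to copositivity with respect to ℝˢ₊ … the problem can be
transformed to ℝˢ and our method … applied")]. -/
theorem nonneg_on_generatedCone_iff (A : Matrix n n ℝ) (G : Matrix n m ℝ) :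
    (∀ x ∈ {x : n → ℝ | ∃ μ : m → ℝ, (∀ j, 0 ≤ μ j) ∧ G *ᵥ μ = x}, 0 ≤ x ⬝ᵥ A *ᵥ x) ↔
      IsCopositive (Gᵀ * A * G) := by
  rw [← simplicial_nonneg_on_cone_iff]
  constructor
  · exact fun h μ hμ => h _ ⟨μ, hμ, rfl⟩
  · rintro h x ⟨μ, hμ, rfl⟩
    exact h μ hμ

end Literature.Combinatorics.Optimization.CopositivitySimplicialPartition
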